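import Mathlib
import Summits.Ventures.HodgeRepro.PeriodCloserC7

/-!
# PeriodCloserC7Chain — the chain of closer C7 assembled on the kernel

Blind re-derivation cell `pub-hodge-repro`, seat night-2 (gen 0).  Target tree path
`lean/Summits/Ventures/HodgeRepro/PeriodCloserC7Chain.lean`.

Over the interface `C7Face L` and the typed ingredients of `PeriodCloserC7.lean` (Parts I and II) this file
PROVES the chain of ROUTE.md §4 item 2 / ROUTE-B §9 (endoscopic
branch), with the three finite steps the route makes on the page done here on the kernel:

* `signPattern_even` — (E3) at every place + Tate's product formula ⟹ `ε(χ′_0) ε(χ′_1) = ε(χ′_2) ε(χ′_3)`: the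
  sign pattern of the four lines is EVEN (ROUTE.md §4 item 2 (f), «STRUCTURE OF (R1)»);
* `exists_flip_to_trivial` — an even pattern is moved to `(+,+,+,+)` by flipping exactly the lines carrying
  `−1`, and that flip pattern is N2-compatible (ROUTE.md §4 item 2 (f)(3), «moves every even pattern to
  (+,+,+,+)»): the finite combinatorics of the sixteen patterns;
* `exists_common_twist` — BHTY 2025 Thm 1.1 for four self-dual characters along ONE split-`𝔭` family
  (with Lemma 4.11 for the signs and `Ξ_𝔭` infinite) gives a COMMON `ν` with all four central values non-zero
  and all four root numbers still `+1` (ROUTE.md §4 item 2 (9): «a common ν exists (infinitely many)»);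

and then the assembly `S4face_of_chain`: from the base admissible datum, flip to (R1), twist to (R2), discharge
(E1)–(E5), get (P′) by Borade et al. Thm 1.4 on `τ = Θ(β)`, (P) by the identification, the Weil-period witness,
and S4 for the face by Lemma Π.  The theorem's hypotheses are exactly the fields of `ChainHypothesesAdm I` (the
bundle of `PeriodCloserC7.lean` with the sign flip asked on admissible data only, the form the route derives;
`S4face_of_chain'` takes the universal bundle `ChainHypotheses I`); the ONE unprinted one is `ident`.  Also: `P_iff_torusPeriod` — under the identification, (P) IS the non-vanishing
of the torus period of the Siegel–Eisenstein series `E^{(2,2)}(·, Φ_{1/2})`, the closing object of ROUTE.md §7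
item 5 (i).

Everything here is conditional on an instantiation of the interface; nothing here says anything about the
status of the Hodge conjecture for CM abelian varieties, which is NOT proved.
-/

set_option autoImplicit false

noncomputable section

namespace Summit.Ventures.HodgeRepro.PeriodCloser

open NumberField

variable {L : Type} [Field L] [NumberField L] [IsCMField L]

/-! ## The finite combinatorics of the sign pattern (ROUTE.md §4 item 2 (f)) -/

/-- The flip pattern of a sign vector: flip exactly the lines carrying `−1`. -/
def flipPattern (ε : Fin 4 → ℤˣ) : Fin 4 → Bool := fun j => decide (ε j = -1)

/-- Flipping exactly the lines carrying `−1` makes every sign `+1`. -/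
theorem flipPattern_spec (ε : Fin 4 → ℤˣ) (j : Fin 4) :
    (if flipPattern ε j then -ε j else ε j) = 1 := by
  unfold flipPattern
  rcases Int.units_eq_one_or (ε j) with h | h <;> simp only [h] <;> decide

/-- For an EVEN pattern (`ε_0 ε_1 = ε_2 ε_3`) the flip pattern is N2-compatible: the numbers of flipped lines
among `{0, 1}` and among `{2, 3}` have the same parity. -/
theorem flipPattern_n2compat (ε : Fin 4 → ℤˣ) (h : ε 0 * ε 1 = ε 2 * ε 3) :
    N2compat (flipPattern ε) := by
  unfold N2compat flipPattern
  rcases Int.units_eq_one_or (ε 0) with h0 | h0 <;> rcases Int.units_eq_one_or (ε 1) with h1 | h1 <;>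
    rcases Int.units_eq_one_or (ε 2) with h2 | h2 <;> rcases Int.units_eq_one_or (ε 3) with h3 | h3 <;>
    simp only [h0, h1, h2, h3] at h ⊢ <;> first | decide | exact absurd h (by decide)

/-- **Every even sign pattern is moved to `(+,+,+,+)` by an N2-compatible flip** (ROUTE.md §4 item 2 (f)(3)). -/
theorem exists_flip_to_trivial (ε : Fin 4 → ℤˣ) (h : ε 0 * ε 1 = ε 2 * ε 3) :
    ∃ J : Fin 4 → Bool, N2compat J ∧ ∀ j, (if J j then -ε j else ε j) = 1 :=
  ⟨flipPattern ε, flipPattern_n2compat ε h, flipPattern_spec ε⟩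

/-- **The sign pattern of a datum satisfying (E3) is even** (ROUTE.md §4 item 2 (f), «STRUCTURE OF (R1)»): with
`ε_v(χ′_0) ε_v(χ′_1) = ε_v(χ′_2) ε_v(χ′_3)` at every place and `ε(½, χ) = ∏_v ε_v`, the product formula gives
`ε(χ′_0) ε(χ′_1) = ε(χ′_2) ε(χ′_3)`. -/
theorem signPattern_even (I : C7Face L) (hPF : ProductFormula I) (d : I.Datum) (h3 : I.E3 d) :
    I.rootNumber (I.chars d 0) * I.rootNumber (I.chars d 1) =
      I.rootNumber (I.chars d 2) * I.rootNumber (I.chars d 3) := by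
  rw [hPF.eq, hPF.eq, hPF.eq, hPF.eq, ← finprod_mul_distrib (hPF.finite _) (hPF.finite _),
    ← finprod_mul_distrib (hPF.finite _) (hPF.finite _)]
  exact finprod_congr h3

/-! ## The common anticyclotomic twist (ROUTE.md §4 item 2 (9), BHTY 2025) -/

/-- **A common `ν` for four self-dual characters with root number `+1`, along one split-`𝔭` family**:
for all but finitely many `ν ∈ Ξ_𝔭` the four root numbers stay `+1` (BHTY Lemma 4.11) and the four central
values are non-zero (BHTY Thm 1.1, four times); `Ξ_𝔭` is infinite, so such a `ν` exists. -/
theorem exists_common_twist (I : C7Face L) (hB : BHTY2025_Thm1_1 I) (hS : BHTY2025_Lemma4_11_split I)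
    (hX : XiInfinite I) (𝔭 : I.Place) (h𝔭 : I.IsSplit 𝔭) (χ : Fin 4 → I.HeckeChar)
    (hsd : ∀ j, I.IsSelfDual (χ j)) (h1 : ∀ j, I.rootNumber (χ j) = 1) :
    ∃ ν : I.Xi 𝔭, ∀ j, I.rootNumber (I.twist 𝔭 (χ j) ν) = 1 ∧ I.centralValue (I.twist 𝔭 (χ j) ν) ≠ 0 := by
  have hbad : (⋃ j : Fin 4,
      ({ν : I.Xi 𝔭 | I.rootNumber (I.twist 𝔭 (χ j) ν) ≠ I.rootNumber (χ j)} ∪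
        {ν : I.Xi 𝔭 | I.rootNumber (I.twist 𝔭 (χ j) ν) = 1 ∧ I.centralValue (I.twist 𝔭 (χ j) ν) = 0})).Finite :=
    Set.finite_iUnion fun j =>
      (hS (χ j) 𝔭 (hsd j) h𝔭).union (hB (χ j) 𝔭 (hsd j) (hX.unramified_of_split 𝔭 h𝔭))
  haveI : Infinite (I.Xi 𝔭) := hX.infinite 𝔭
  obtain ⟨ν, -, hν⟩ := ((Set.infinite_univ (α := I.Xi 𝔭)).sdiff hbad).nonempty
  simp only [Set.mem_iUnion, Set.mem_union, Set.mem_setOf_eq, not_exists, not_or, not_and,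
    not_not] at hν
  refine ⟨ν, fun j => ?_⟩
  obtain ⟨hε, hL⟩ := hν j
  have hε' : I.rootNumber (I.twist 𝔭 (χ j) ν) = 1 := by rw [hε, h1 j]
  exact ⟨hε', fun h0 => (hL hε' h0)⟩

/-! ## The sign flip of ROUTE-B §9.10 from its local inputs -/

/-- **The local inputs of the sign flip** (ROUTE-B §9.10 (1)–(2); ROUTE.md §4 item 2 (f)(1)–(2)) for one self-dual
`χ` and the global quadratic anticyclotomic character `ν♭ = ω_α ∘ N_{L/k}`, `L = k(√d)`: the local ratios
`r_v = ε_v(½, χν♭, ψ_δ) / ε_v(½, χ, ψ_δ)`, the Hilbert symbols `h_v = (α, d)_v`, and what the printed inputs say about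
them — `r_v = h_v` at every non-real place (both are `−1` exactly at the inert `v` with `v(α)` odd: Gan–Gross–Prasad
Prop. 9 second part + Kudla Prop. 3.8 (i)/(ii) give `r_v = (−1)^n` at a tame inert `v`, `n = 1`; both are `+1` at split
`v`, at `v | 2𝔫` where `α` is a square, and at unramified inert `v` with `v(α)` even), `r_w = 1` at the real places
(`ν♭_w = 1`, `N_{ℂ/ℝ} > 0`), `∏_{w real} h_w = ∏_w sgn_w(α) = −1` (`α` negative at exactly one real place, `d` totally
negative), and Hilbert's product formula `∏_v h_v = 1`. -/
structure FlipLocalData (I : C7Face L) (χ : I.HeckeChar) where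
  /-- the real places of `k` -/
  Real : Set I.Place
  /-- the real places are finitely many -/
  real_finite : Real.Finite
  /-- the local ratio `r_v = ε_v(χν♭)/ε_v(χ)` -/
  ratio : I.Place → ℤˣ
  /-- all but finitely many ratios are `1` -/
  ratio_finite : Function.HasFiniteMulSupport ratio
  /-- `ε_v(χν♭) = r_v · ε_v(χ)` -/
  local_flip : ∀ v, I.localRootNumber v (I.flip χ) = ratio v * I.localRootNumber v χ
  /-- the Hilbert symbols `h_v = (α, d)_v` -/
  hilbert : I.Place → ℤˣ
  /-- all but finitely many symbols are `1` -/
  hilbert_finite : Function.HasFiniteMulSupport hilbert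
  /-- Hilbert's product formula -/
  hilbert_product : ∏ᶠ v, hilbert v = 1
  /-- at every non-real place the ratio IS the Hilbert symbol -/
  ratio_eq_hilbert : ∀ v, v ∉ Real → ratio v = hilbert v
  /-- at a real place the ratio is `1` -/
  ratio_real : ∀ v, v ∈ Real → ratio v = 1
  /-- `α` is negative at exactly one real place -/
  hilbert_real : ∏ᶠ v ∈ Real, hilbert v = -1

/-- A finite product over all places splits into the real places and the rest. -/
theorem finprod_split_real {Place : Type} (f : Place → ℤˣ) (hf : Function.HasFiniteMulSupport f)
    (R : Set Place) : ∏ᶠ v, f v = (∏ᶠ v ∈ R, f v) * ∏ᶠ v ∈ Set.univ \ R, f v := by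
  rw [← finprod_mem_univ, ← finprod_mem_mul_sdiff' (Set.subset_univ R)
    (hf.subset Set.inter_subset_right)]

/-- **The sign flip, from its local inputs** (ROUTE-B §9.10 (2) on the kernel): the product of the ratios over
the non-real places equals the product of the Hilbert symbols there, which is `−1` by the product formula and the
single negative real place; the ratios at the real places are `1`; hence `∏_v r_v = −1` and, by Tate's product
formula for both characters, `ε(½, χν♭) = −ε(½, χ)`. -/
theorem flip_rootNumber_of_local (I : C7Face L) (hPF : ProductFormula I) (χ : I.HeckeChar)
    (D : FlipLocalData I χ) : I.rootNumber (I.flip χ) = -I.rootNumber χ := by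
  have hreal : ∏ᶠ v ∈ D.Real, D.ratio v = 1 :=
    finprod_mem_of_eqOn_one fun v hv => D.ratio_real v hv
  have hrest : ∏ᶠ v ∈ Set.univ \ D.Real, D.ratio v = ∏ᶠ v ∈ Set.univ \ D.Real, D.hilbert v :=
    finprod_mem_congr rfl fun v hv => D.ratio_eq_hilbert v hv.2
  have hH := D.hilbert_product
  rw [finprod_split_real D.hilbert D.hilbert_finite D.Real, D.hilbert_real, neg_one_mul] at hH
  have hX : ∏ᶠ v ∈ Set.univ \ D.Real, D.hilbert v = -1 := neg_eq_iff_eq_neg.mp hH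
  have hratio : ∏ᶠ v, D.ratio v = -1 := by
    rw [finprod_split_real D.ratio D.ratio_finite D.Real, hreal, hrest, hX, one_mul]
  rw [hPF.eq, hPF.eq, finprod_congr D.local_flip,
    finprod_mul_distrib D.ratio_finite (hPF.finite χ), hratio, neg_one_mul]

/-! ## The reciprocity form of (E2) (ROUTE-B §9.9 (c); ROUTE.md §4 item 2 (9)(c)) -/

/-- **Abstract norm-residue data of the cyclic extension `L/k`**: the possible global discriminants `a ∈ k^×` of a
hermitian line, their local classes `v ↦ ω_{L_v/k_v}(a) ∈ {±1}` (TP1-defs, arXiv:2402.16808 p0010:L12–30: for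
`𝔼 = k × k` the invariant `ω(λ)` is the pair of the two lines' signs), Hilbert reciprocity `∏_v ω_v(a) = 1`, and the
converse «a global `a` with prescribed local classes `(c_v)_v` exists iff `∏_v c_v = 1`» — the reciprocity kernel
`k^× · N(𝔸_L^×)` of the cyclic `L/k` (Harari, *Galois cohomology and class field theory*, Thm 15.4 p0237:L9–13,
Cor 13.24 p0217:L7–9, as cited in ROUTE.md §4 item 2 (9); TP1 p0006:L18–20 prints the forward direction). -/
structure NormResidueData (Place : Type) where
  /-- the global elements `a ∈ k^×` modulo norms -/
  Global : Type
  /-- the local norm-residue symbols `ω_{L_v/k_v}(a)` -/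
  omega : Global → Place → ℤˣ
  /-- all but finitely many local symbols are `1` -/
  finite : ∀ a : Global, Function.HasFiniteMulSupport (omega a)
  /-- Hilbert reciprocity -/
  product_one : ∀ a : Global, ∏ᶠ v, omega a v = 1
  /-- the converse: prescribed local classes with product `1` come from a global element -/
  exists_of_product_one : ∀ c : Place → ℤˣ, Function.HasFiniteMulSupport c → ∏ᶠ v, c v = 1 →
    ∃ a : Global, ∀ v, omega a v = c v

/-- A global class with prescribed local classes `c_v` exists iff `∏_v c_v = 1`. -/
theorem NormResidueData.exists_global_iff {Place : Type} (D : NormResidueData Place) (c : Place → ℤˣ)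
    (hc : Function.HasFiniteMulSupport c) : (∃ a : D.Global, ∀ v, D.omega a v = c v) ↔ ∏ᶠ v, c v = 1 := by
  constructor
  · rintro ⟨a, ha⟩
    rw [← finprod_congr ha]
    exact D.product_one a
  · exact D.exists_of_product_one c hc

/-- **(E2) for ONE line at ALL places is the global root number `+1`** (ROUTE-B §9.9 (c), ROUTE.md §4 item 2
(9)(c): «(E2) at ALL places for line j ⟺ ε(½, χ_j′) = +1 — … describes a CHOICE, not a condition»): TP1's local
condition at `v` for the line `W_j = (L, a_j x ȳ)` reads `ω_v(a_j) = ε_v(½, χ′_j, ψ_{δ,v})`; a global `a_j` meeting it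
at every place exists iff `∏_v ε_v(½, χ′_j) = ε(½, χ′_j)` is `+1` (Tate's product formula + reciprocity). -/
theorem E2_line_iff_rootNumber (I : C7Face L) (hPF : ProductFormula I) (D : NormResidueData I.Place)
    (χ : I.HeckeChar) :
    (∃ a : D.Global, ∀ v, D.omega a v = I.localRootNumber v χ) ↔ I.rootNumber χ = 1 := by
  rw [D.exists_global_iff _ (hPF.finite χ), hPF.eq χ]

/-! ## The hypotheses of the chain, in their precise (admissible-data) form -/

/-- **ROUTE-DERIVED — the sign flip on the admissible data** (the precise form of `FlipRootNumber`): ROUTE-B §9.10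
builds ONE global quadratic anticyclotomic `ν♭ = ω_α ∘ N_{L/k}` from the conductors of the four characters of the
datum (`α` a square at every `v | 2𝔫`, `𝔫 = 𝔡_{L/k} · ∏_j N𝔣(χ′_j)`), and derives `ε(½, χ′_j ν♭) = −ε(½, χ′_j)` for
THOSE four characters (and for their split-`𝔭` twists, since a split place moves no parity — ROUTE.md §4 item 2
(f)(2)).  `FlipRootNumber` of `PeriodCloserC7.lean` quantifies over every self-dual character; this hypothesis
asks the flip only on the characters of admissible data, which is what the route derives. -/
def FlipRootNumberAdm (I : C7Face L) : Prop :=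
  ∀ d : I.Datum, I.Admissible d → ∀ j : Fin 4, I.rootNumber (I.flip (I.chars d j)) = -I.rootNumber (I.chars d j)

/-- The universal flip implies the admissible-data flip (the characters of admissible data are self-dual). -/
theorem FlipRootNumberAdm.of_univ (I : C7Face L) (hF : FlipRootNumber I) (hA : AdmissibleFamily I) :
    FlipRootNumberAdm I :=
  fun d hd j => hF _ (hA.selfDual d hd j)

/-- **The hypotheses of the chain, precise form**: as `ChainHypotheses` but with the sign flip asked only on
admissible data (`FlipRootNumberAdm`).  The ONE unprinted hypothesis is `ident`; every other field is PRINTED or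
ROUTE-DERIVED as its docstring states. -/
structure ChainHypothesesAdm (I : C7Face L) : Prop where
  /-- UNPRINTED: the identification (i) -/
  ident : Identification I
  /-- Lemma Π -/
  lemmaPi : LemmaPi I
  /-- the witness `Y = f(X)` -/
  witness : PeriodWitness I
  /-- Borade et al. 2025 Thm 1.4 -/
  tp1 : Borade2025_Thm1_4 I
  /-- BHTY 2025 Thm 1.1 -/
  bhty : BHTY2025_Thm1_1 I
  /-- BHTY 2025 Lemma 4.11, split case -/
  bhtySplit : BHTY2025_Lemma4_11_split I
  /-- `Ξ_𝔭` infinite; split ⟹ unramified -/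
  xi : XiInfinite I
  /-- Tate's product formula -/
  productFormula : ProductFormula I
  /-- the sign flip of ROUTE-B §9.10, on admissible data -/
  flipAdm : FlipRootNumberAdm I
  /-- the local discharge -/
  discharge : LocalDischarge I
  /-- the admissible family -/
  family : AdmissibleFamily I

/-- The bundle `ChainHypotheses` (universal flip) gives the precise bundle. -/
theorem ChainHypotheses.toAdm (I : C7Face L) (H : ChainHypotheses I) : ChainHypothesesAdm I :=
  ⟨H.ident, H.lemmaPi, H.witness, H.tp1, H.bhty, H.bhtySplit, H.xi, H.productFormula,
    FlipRootNumberAdm.of_univ I H.flip H.family, H.discharge, H.family⟩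

/-! ## The chain -/

/-- **(P′) on the endoscopic branch** (ROUTE.md §4 item 2 (8)): if the datum satisfies (E1), (E2), (E4), (E5)
then `τ = Θ(β)` carries both toric periods (Borade et al. 2025 Thm 1.4, once per torus) and a non-zero
`(2,0)`-lift — (P′).  ((E3) is not used here; it is what makes the sign pattern even, `signPattern_even`.) -/
theorem P'_of_endoscopic (I : C7Face L) (hTP1 : Borade2025_Thm1_4 I) (d : I.Datum)
    (h : I.Endoscopic d) : I.P' := by
  obtain ⟨h1, h2, -, h4, h5⟩ := h
  exact ⟨d, I.thetaLift (I.betaOf d),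
    fun i => (hTP1 d i).mpr ⟨h1 i, fun v => h2 i v, mul_ne_zero (h4 _) (h4 _)⟩, h5⟩

/-- **Under the identification, (P) is the non-vanishing of the torus period of `E^{(2,2)}(·, Φ_{1/2})`**
(ROUTE.md §4 item 2 (3); §7 item 5 (i): «the closing computation»). -/
theorem P_iff_torusPeriod (I : C7Face L) (hI : Identification I) : I.P ↔ I.TorusPeriodNonzero := by
  unfold C7Face.P C7Face.TorusPeriodNonzero
  simp only [hI.doubling]

/-- **The chain of equivalences of closer C7** (ROUTE.md §4 item 2, v2.3): S4 for the face ⟺ a Weil-period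
witness (Lemma Π); (P) ⟺ (P′) (the seesaw form of the identification); (P) ⟺ the torus period of the
Siegel–Eisenstein series is non-zero (the doubling form); and (P) ⟹ S4 for the face (the witness `Y = f(X)`). -/
theorem chain_of_equivalences (I : C7Face L) (hI : Identification I) (hPi : LemmaPi I)
    (hW : PeriodWitness I) :
    (I.S4face ↔ I.WeilPeriodWitness) ∧ (I.P ↔ I.P') ∧ (I.P ↔ I.TorusPeriodNonzero) ∧ (I.P → I.S4face) :=
  ⟨hPi, hI.seesaw, P_iff_torusPeriod I hI, fun hP => hPi.mpr (hW hP)⟩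

/-- **The torus period closes the face**: a non-zero torus period of `E^{(2,2)}(·, Φ_{1/2})` for some datum
gives S4 for the face — under the identification, Lemma Π and the witness. -/
theorem S4face_of_torusPeriod (I : C7Face L) (hI : Identification I) (hPi : LemmaPi I)
    (hW : PeriodWitness I) (hT : I.TorusPeriodNonzero) : I.S4face :=
  hPi.mpr (hW ((P_iff_torusPeriod I hI).mpr hT))

/-- **(R1) ∧ (R2) on an admissible datum closes the face** (ROUTE.md §4 item 2 (f): «(P′)(i) ∧ (ii) ∧ (iii)
holds on τ = Θ(β) iff (R1) and (R2) … and the identification (i) is the ONLY unprinted step»). -/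
theorem S4face_of_R1_R2 (I : C7Face L) (H : ChainHypothesesAdm I) (d : I.Datum) (hd : I.Admissible d)
    (hR1 : I.R1 d) (hR2 : I.R2 d) : I.S4face := by
  have hEnd : I.Endoscopic d :=
    ⟨H.discharge.e1 d hd, H.discharge.e2_of_r1 d hd hR1, H.discharge.e3 d hd, hR2, H.discharge.e5 d hd⟩
  exact H.lemmaPi.mpr (H.witness (H.ident.seesaw.mpr (P'_of_endoscopic I H.tp1 d hEnd)))

/-- **THE CLOSER C7 ON THE ENDOSCOPIC BRANCH, assembled.**  Under the hypotheses `ChainHypothesesAdm I` — the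
printed theorems (Borade et al. 2025 Thm 1.4; BHTY 2025 Thm 1.1 and Lemma 4.11; Tate's product formula),
the route-derived steps (Lemma Π over its printed inputs, the witness `Y = f(X)`, the sign flip of ROUTE-B
§9.10, the local discharge of (E1)/(E2)/(E3)/(E5), the admissible family) and the ONE unprinted identification
`H.ident` — S4 holds for the face.  Proof: start from the base datum; its sign pattern is even
(`signPattern_even`); flip the lines carrying `−1` (`exists_flip_to_trivial`, an N2-compatible flip, the sign
flip of §9.10) to reach (R1); twist along the split-`𝔭` family to a common `ν` (`exists_common_twist`) to reach
(R2) with (R1) kept; then `S4face_of_R1_R2`. -/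
theorem S4face_of_chain (I : C7Face L) (H : ChainHypothesesAdm I) : I.S4face := by
  obtain ⟨d₀, hd₀⟩ := H.family.base
  have heven := signPattern_even I H.productFormula d₀ (H.discharge.e3 d₀ hd₀)
  obtain ⟨J, hJ, hJ1⟩ := exists_flip_to_trivial (I.signPattern d₀) heven
  obtain ⟨d₁, hd₁, hchars₁⟩ := H.family.flip_mem d₀ J hd₀ hJ
  have hR1₁ : I.R1 d₁ := by
    intro j
    have hj := hJ1 j
    simp only [C7Face.signPattern] at hj
    rw [hchars₁]
    simp only [flipOn]
    by_cases hJj : J j = true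
    · rw [if_pos hJj, H.flipAdm d₀ hd₀ j]
      rwa [if_pos hJj] at hj
    · rw [if_neg hJj]
      rwa [if_neg hJj] at hj
  obtain ⟨𝔭, h𝔭⟩ := H.family.split
  obtain ⟨ν, hν⟩ := exists_common_twist I H.bhty H.bhtySplit H.xi 𝔭 h𝔭 (I.chars d₁)
    (H.family.selfDual d₁ hd₁) hR1₁
  obtain ⟨d₂, hd₂, hchars₂⟩ := H.family.twist_mem d₁ 𝔭 ν hd₁ h𝔭
  have hR1₂ : I.R1 d₂ := fun j => by
    rw [hchars₂]
    exact (hν j).1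
  have hR2₂ : I.R2 d₂ := fun j => by
    show I.centralValue (I.chars d₂ j) ≠ 0
    rw [hchars₂]
    exact (hν j).2
  exact S4face_of_R1_R2 I H d₂ hd₂ hR1₂ hR2₂

/-- The same under the bundle `ChainHypotheses I` of `PeriodCloserC7.lean` (universal flip). -/
theorem S4face_of_chain' (I : C7Face L) (H : ChainHypotheses I) : I.S4face :=
  S4face_of_chain I (ChainHypotheses.toAdm I H)

end Summit.Ventures.HodgeRepro.PeriodCloser

end
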